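import Summits.QuantumFields.YangMills.Theorems.BalabanUVNodesN11Sect3SupplySpliceLabels

/-!
# DAG node N11 — THE MINIMAL §3 SUPPLY WITH THE LEVEL-`k` BOUNDARY TERM RE-ISSUED BY THE SUPPLIER: `graftAboveB k t u` (old `𝐄 ∕ 𝐑` at the levels `≤ k` and old `𝐁` at the
# levels `< k` from the exposed witness, `𝐁^{(k)}` and everything above from the supplier) — LOCATED-SPACEB's obligation (O1) becomes (O1′), a clause on the SUPPLIER's OWN term,
# and the whole supply reads on the supplier's terms only; label-keyed as in `…Sect3SupplySpliceLabels`

Cell `pub-ymgap`, YM-PLAN Track A (HUMAN RULING D-0062 ∕ D-0149), seat `pub-ymgap-dag-n11-e` (g15; R134 fan-out row N11∕s3), route `BalabanUVNodes` rev 25 (v1.7 `CoPH` key), item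
K1⁷ `StabilityBAtRecordR13SepCoPH` = stmt-QuantumFields-20542; DEFINITION lane (`--supports 20542 --as helper`: one `def` + theorems), count-neutral.  [III] =
[Balaban1988Convergent].  Over this seat's `…Sect3SupplySpliceDefs ∕ Frame ∕ Splice ∕ Labels` (p585501 ∕ p585728+p588879 ∕ p586169 ∕ p588617).

WHY THIS FILE.  In `Sect3SpliceSupplyAt` and its 𝐓-present ∕ labelled forms the obligation (O1) — the bound (2.42) and analyticity (2.41)(ii) of the OLD boundary term
`𝐁^{(k)}` of the EXPOSED witness on the expansion child's LARGER space `Ũ^c_k(X)` (LOCATED-SPACEB; `…SpliceFrame.towerOfTerms_spaceB_parent_subset_child`) — is the one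
clause not about the supplier's own objects: for an arbitrary law-abiding exposed witness it need not hold, and print does not supply it.  But the 𝐓-image form at index `k+1` is
EXISTENTIAL in its term values (def-T's `TLaw₁₃CoPH` ∕ `HasSect2FormTAEZS`): nothing forces the 𝐓-image witness to keep the OLD `𝐁^{(k)}` at an expansion child.  So let the
supplier RE-ISSUE the level-`k` boundary term there: the spliced witness `graftAboveB k (t (init s′)) (tnew s′)` takes `𝐄 ∕ 𝐑` at the levels `≤ k` and `𝐁` at the levels `< k`
from the exposed witness (their laws transfer across frames, `…SpliceFrame`), and `𝐁^{(k)}`, `𝐄^{(k+1)}, 𝐑^{(k+1)}, 𝐁^{(k+1)}` from the supplier.  Then EVERY obligation is a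
clause on the supplier's own terms: (O1′) its `𝐁^{(k)}` obeys (2.42) ∕ (2.41)(ii) on the child's `Ũ^c_k(X)` (void at `k = 0`; the supplier MAY choose the old `𝐁^{(k)}` when that
happens to qualify, e.g. at `k = 1` by `…Splice.o1_one_of_lawsRT`), (O2) r11's new-term obligations + analyticity at `k+1`, (O3′) the 𝐓-image identity ((3.24)–(3.25) p.270, §3
p.279) for `graftAboveB`.  The exposed witness enters only through the VALUES of its old terms inside `A_{k+1}` — inherent to the identity.
§1 `graftAboveB` + faces · `lfNewTerms_graftAboveB`.  §2 `lawsT_child_graftAboveB_of_rows` (the child's laws from the parent's `LawsRT` + (O1′) + (O2), by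
`…SpliceFrame.lawsT_towerOfTerms_crossFrame` with `𝐁`-agreement below `k` only).  §3 ★ `sect3SupplyAt_of_ownBSupply_of_guard` (master, any guard with `¬G ⇒ 𝐓ρ_k ≡ 0`) ·
★★ `sect3SupplyAt_of_ownBSupply_at_present_children` · ★★★ `sect3SupplyAt_of_ownBSupply_at_labels` (print's indexing `σ(s₀, t)`, every obligation on the supplier's terms).

HONEST FRAMING.  Count-neutral kernel bookkeeping + one term-value transformer; the obligations ([III] Sect. 1 ∕ §3 ∕ Thm 2 at the objects of record, now including the
re-issued `𝐁^{(k)}`) are DISPLAYED, not proved; nothing of Bałaban asserted; N11 NOT discharged; K1⁷ NOT closed; counts unmoved (typed 28∕28 · discharged 5∕27).  One finite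
`𝕋⁴_{L^K}` programme at fixed `ε = L^{−K}`; NOT ℝ⁴, NOT OS, NOT a mass gap, NOT Clay.  No `sorry`, no `axiom`, no `instance`, no `notation`.
Sources: [III] Theorem p.245, Thm 1 p.262, Thm 2 p.263, §2 p.262, (3.1)–(3.5) pp.264–265, (3.20) p.269, (3.24)–(3.25) p.270, §3 p.279, (2.23)–(2.31) pp.258–260, (2.34)–(2.42) p.261.
-/

noncomputable section

open MeasureTheory
open scoped BigOperators Matrix.Norms.L2Operator

namespace Summit.QuantumFields.YangMills.Theorems.BalabanUVNodesN11Sect3SupplySpliceOwnBoundary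

open Literature.MathematicalPhysics.QuantumFieldTheory.Balaban1983to89 T4Continuum Node00 Node00.Tk DagBinding
open Step B14.Eq227LocalizedTerms
open Literature.MathematicalPhysics.QuantumFieldTheory.Balaban1983to89.B14SeparationOfRecord (exists_label_of_slotsTOfRecord_succ_ne_zero)
open BalabanUVNodesN11Sect3SupplyDefs (Sect3SupplyAt)
open BalabanUVNodesN11Sect3SupplySpliceDefs
open BalabanUVNodesN11Sect3SupplySpliceFrame
open BalabanUVNodesN11Sect3SupplySplice (lawsT_child_absent_of_newEClauses)
open BalabanUVNodesN11NoExpansionStepReductionRePinnedUnivECoPH (newEClauses_of_lawsT_of_eqE)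

/-! ## §1  The graft with the level-`k` boundary term from the new source -/

section Graft

variable {P : Params} {𝔸 : Type*} {V : Type*} {M : ℕ}

/-- **TERM VALUES GRAFTED ABOVE LEVEL `k`, THE BOUNDARY TERM FROM LEVEL `k` ON**: `𝐄 ∕ 𝐑` of `t` at the levels `≤ k` and of `u` above; `𝐁` of `t` at the levels `< k` and of `u`
at the levels `≥ k` — the 𝐓-image witness at an expansion child whose supplier re-issues the level-`k` boundary term. [cite: Balaban1988Convergent, §2 p.262, (2.40)–(2.42) p.261, §3 p.279 (bookkeeping)] -/
def graftAboveB (k : ℕ) (t u : Sect2.TermValues P 𝔸 V M) : Sect2.TermValues P 𝔸 V M where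
  E j X z g φ := if j ≤ k then t.E j X z g φ else u.E j X z g φ
  R j X φ := if j ≤ k then t.R j X φ else u.R j X φ
  B j X φ a := if j < k then t.B j X φ a else u.B j X φ a

/-- The 𝐄-component of `graftAboveB` IS `graftAbove`'s (`rfl`) — so universality in 𝐄 is `universalE_graftAbove`'s. [cite: Balaban1988Convergent, (2.25) p.259 (bookkeeping)] -/
theorem graftAboveB_E (k : ℕ) (t u : Sect2.TermValues P 𝔸 V M) : (graftAboveB k t u).E = (graftAbove k t u).E := rfl

/-- At the levels `≤ k` the graft has `t`'s `𝐄`. [cite: Balaban1988Convergent, §2 p.262 (bookkeeping)] -/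
theorem graftAboveB_E_of_le {k : ℕ} (t u : Sect2.TermValues P 𝔸 V M) {j : ℕ} (hj : j ≤ k) (X : (Sect2.domSys P M j).Dom) (z : Site P j) (g : ℝ)
    (φ : Sect2.CPair P 𝔸) : (graftAboveB k t u).E j X z g φ = t.E j X z g φ := if_pos hj

/-- At the levels `≤ k` the graft has `t`'s `𝐑`. [cite: Balaban1988Convergent, §2 p.262 (bookkeeping)] -/
theorem graftAboveB_R_of_le {k : ℕ} (t u : Sect2.TermValues P 𝔸 V M) {j : ℕ} (hj : j ≤ k) (X : (Sect2.domSys P M j).Dom) (φ : Sect2.CPair P 𝔸) :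
    (graftAboveB k t u).R j X φ = t.R j X φ := if_pos hj

/-- Below the level `k` the graft has `t`'s `𝐁`. [cite: Balaban1988Convergent, (2.40) p.261 (bookkeeping)] -/
theorem graftAboveB_B_of_lt {k : ℕ} (t u : Sect2.TermValues P 𝔸 V M) {j : ℕ} (hj : j < k) (X : (Sect2.domSys P M j).Dom) (φ : Sect2.CPair P 𝔸)
    (a : SFluct P V) : (graftAboveB k t u).B j X φ a = t.B j X φ a := if_pos hj

/-- From the level `k` on the graft has `u`'s `𝐁`. [cite: Balaban1988Convergent, (2.40)–(2.41) p.261, §3 p.279 (bookkeeping)] -/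
theorem graftAboveB_B_of_le {k : ℕ} (t u : Sect2.TermValues P 𝔸 V M) {j : ℕ} (hj : k ≤ j) (X : (Sect2.domSys P M j).Dom) (φ : Sect2.CPair P 𝔸)
    (a : SFluct P V) : (graftAboveB k t u).B j X φ a = u.B j X φ a := if_neg (Nat.not_lt.mpr hj)

/-- Above the level `k` the graft has `u`'s `𝐄`. [cite: Balaban1988Convergent, §3 p.279 (bookkeeping)] -/
theorem graftAboveB_E_of_lt {k : ℕ} (t u : Sect2.TermValues P 𝔸 V M) {j : ℕ} (hj : k < j) (X : (Sect2.domSys P M j).Dom) (z : Site P j) (g : ℝ)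
    (φ : Sect2.CPair P 𝔸) : (graftAboveB k t u).E j X z g φ = u.E j X z g φ := if_neg (Nat.not_le.mpr hj)

/-- Above the level `k` the graft has `u`'s `𝐑`. [cite: Balaban1988Convergent, §3 p.279 (bookkeeping)] -/
theorem graftAboveB_R_of_lt {k : ℕ} (t u : Sect2.TermValues P 𝔸 V M) {j : ℕ} (hj : k < j) (X : (Sect2.domSys P M j).Dom) (φ : Sect2.CPair P 𝔸) :
    (graftAboveB k t u).R j X φ = u.R j X φ := if_neg (Nat.not_le.mpr hj)

/-- The level-`(k+1)` 𝐄 of the graft is the new source's, as a function. [cite: Balaban1988Convergent, §3 p.279 (bookkeeping)] -/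
theorem graftAboveB_E_succ (k : ℕ) (t u : Sect2.TermValues P 𝔸 V M) (X : (Sect2.domSys P M (k + 1)).Dom) (z : Site P (k + 1)) (g : ℝ) :
    (graftAboveB k t u).E (k + 1) X z g = u.E (k + 1) X z g :=
  funext fun φ => graftAboveB_E_of_lt t u (Nat.lt_succ_self k) X z g φ

/-- The level-`(k+1)` 𝐑 of the graft is the new source's, as a function. [cite: Balaban1988Convergent, §3 p.279 (bookkeeping)] -/
theorem graftAboveB_R_succ (k : ℕ) (t u : Sect2.TermValues P 𝔸 V M) (X : (Sect2.domSys P M (k + 1)).Dom) :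
    (graftAboveB k t u).R (k + 1) X = u.R (k + 1) X :=
  funext fun φ => graftAboveB_R_of_lt t u (Nat.lt_succ_self k) X φ

/-- At any level `j ≥ k` the 𝐁 of the graft is the new source's, as a function of the configuration. [cite: Balaban1988Convergent, (2.41) p.261 (bookkeeping)] -/
theorem graftAboveB_B_fun_of_le {k : ℕ} (t u : Sect2.TermValues P 𝔸 V M) {j : ℕ} (hj : k ≤ j) (X : (Sect2.domSys P M j).Dom) (a : SFluct P V) :
    (fun φ => (graftAboveB k t u).B j X φ a) = fun φ => u.B j X φ a :=
  funext fun φ => graftAboveB_B_of_le t u hj X φ a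

variable [NormedRing 𝔸] [NormedAlgebra ℂ 𝔸] [CompleteSpace 𝔸] {G : Type*} [GaugeGroup G]

/-- **r11's NEW-TERM PACKAGE transports from `u` to `graftAboveB k t u`** on one frame (it reads the level `k+1` only, where the graft is `u`).
[cite: Balaban1988Convergent, §2 p.262 (bookkeeping)] -/
theorem lfNewTerms_graftAboveB (S : Sect2.Setting 𝔸 G) (Rz : Sect2.Residual P 𝔸) (Ω : ℕ → Set (Site P 0)) {k : ℕ} {t u : Sect2.TermValues P 𝔸 V M}
    (h : LFNewTerms (Sect2.towerOfTerms S Rz M Ω u) S.lf S.βc k) : LFNewTerms (Sect2.towerOfTerms S Rz M Ω (graftAboveB k t u)) S.lf S.βc k := by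
  have hlt := Nat.lt_succ_self k
  refine ⟨h.rg, fun X z g φ ψ hφψ => ?_, fun X φ ψ hφψ => ?_, fun X z g v φ => ?_, fun X v φ => ?_, ⟨fun h1 X z g φ hg0 hgγ hφ => ?_, fun h1 X φ hφ => ?_, fun h1 X φ a hφ => ?_⟩⟩
  · show (graftAboveB k t u).E (k + 1) X z g φ = (graftAboveB k t u).E (k + 1) X z g ψ
    rw [graftAboveB_E_of_lt t u hlt, graftAboveB_E_of_lt t u hlt]; exact h.localDepE X z g φ ψ hφψ
  · show (graftAboveB k t u).R (k + 1) X φ = (graftAboveB k t u).R (k + 1) X ψ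
    rw [graftAboveB_R_of_lt t u hlt, graftAboveB_R_of_lt t u hlt]; exact h.localDepR X φ ψ hφψ
  · show (graftAboveB k t u).E (k + 1) X z g _ = (graftAboveB k t u).E (k + 1) X z g φ
    rw [graftAboveB_E_of_lt t u hlt, graftAboveB_E_of_lt t u hlt]; exact h.gaugeInvE X z g v φ
  · show (graftAboveB k t u).R (k + 1) X _ = (graftAboveB k t u).R (k + 1) X φ
    rw [graftAboveB_R_of_lt t u hlt, graftAboveB_R_of_lt t u hlt]; exact h.gaugeInvR X v φ
  · show ‖(graftAboveB k t u).E (k + 1) X z g φ‖ ≤ _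
    rw [graftAboveB_E_of_lt t u hlt]; exact h.improved.boundE h1 X z g φ hg0 hgγ hφ
  · show ‖(graftAboveB k t u).R (k + 1) X φ‖ ≤ _
    rw [graftAboveB_R_of_lt t u hlt]; exact h.improved.boundR h1 X φ hφ
  · show ‖(graftAboveB k t u).B (k + 1) X φ a‖ ≤ _
    rw [graftAboveB_B_of_le t u (Nat.le_succ k)]; exact h.improved.boundB h1 X φ a hφ

end Graft

variable {F : T4Family} {N : ℕ} [NeZero N]
variable (θ : Stage13HParams F N) (p : B12.RunParams)

/-! ## §2  The child's laws for the graft with the re-issued boundary term -/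

section ChildLaws

/-- **THE 𝐓-IMAGE LAWS AT AN EXPANSION CHILD for `graftAboveB k tpar u`**: from the parent's inductive assumptions for `tpar` (`Sect2.LawsRT` at `init s′`), (O1′) the bound and
analyticity of the SUPPLIER's `u.B k` on the child's `Ũ^c_k(X)` (void at `k = 0`), and (O2) r11's new-term obligations + analyticity at `k+1` for `u` — by
`…SpliceFrame.lawsT_towerOfTerms_crossFrame` with `𝐁`-agreement below `k` only. [cite: Balaban1988Convergent, §2 p.262, §3 p.279, (2.27)–(2.31) pp.259–260, (2.38)–(2.42) p.261] -/
theorem lawsT_child_graftAboveB_of_rows {k : ℕ} (s : SeqOfRecord F θ.ν θ.τ9.M (gOfRecord₁₃ F N θ.toStage13Params p) p.K (k + 1)) {tpar u : Sect2.TermValues (F.P p.K) (MatA N) (FluctV N) θ.τ9.M}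
    (hlaw : Sect2.LawsRT (sect2TowerOfRecord F N (FluctV N) p.K (settingOfRecord₁₃ F N θ.toStage13Params p) (θ.rzAt p s.init) s.init tpar) (settingOfRecord₁₃ F N θ.toStage13Params p).lf k)
    (hO1 : 1 ≤ k →
      (∀ (X : (Sect2.domSys (F.P p.K) θ.τ9.M k).Dom) (φ : Sect2.CPair (F.P p.K) (MatA N)) (a : SFluct (F.P p.K) (FluctV N)),
        φ ∈ (sect2TowerOfRecord F N (FluctV N) p.K (settingOfRecord₁₃ F N θ.toStage13Params p) (θ.rzAt p s) s u).spaceB k X →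
          ‖u.B k X φ a‖ ≤ (settingOfRecord₁₃ F N θ.toStage13Params p).lf.B₀ * Real.exp (-(settingOfRecord₁₃ F N θ.toStage13Params p).lf.κ * (Sect2.domSys (F.P p.K) θ.τ9.M k).dj X)) ∧
      (∀ (X : (Sect2.domSys (F.P p.K) θ.τ9.M k).Dom) (a : SFluct (F.P p.K) (FluctV N)),
        AnalyticOnNhd ℂ (fun φ => u.B k X φ a) ((sect2TowerOfRecord F N (FluctV N) p.K (settingOfRecord₁₃ F N θ.toStage13Params p) (θ.rzAt p s) s u).spaceB k X)))
    (hO2 : Step.LFNewTerms (sect2TowerOfRecord F N (FluctV N) p.K (settingOfRecord₁₃ F N θ.toStage13Params p) (θ.rzAt p s) s u) (settingOfRecord₁₃ F N θ.toStage13Params p).lf (settingOfRecord₁₃ F N θ.toStage13Params p).βc k)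
    (hanE : ∀ (X : (Sect2.domSys (F.P p.K) θ.τ9.M (k + 1)).Dom) (z : Site (F.P p.K) (k + 1)) (g : ℝ), 0 ≤ g → g ≤ (settingOfRecord₁₃ F N θ.toStage13Params p).lf.γ →
      AnalyticOnNhd ℂ (u.E (k + 1) X z g)
        ((sect2TowerOfRecord F N (FluctV N) p.K (settingOfRecord₁₃ F N θ.toStage13Params p) (θ.rzAt p s) s u).space (k + 1) X
          ((settingOfRecord₁₃ F N θ.toStage13Params p).lf.alpha0 ((settingOfRecord₁₃ F N θ.toStage13Params p).flow.g (k + 1))) ((settingOfRecord₁₃ F N θ.toStage13Params p).lf.alpha1 ((settingOfRecord₁₃ F N θ.toStage13Params p).flow.g (k + 1)))))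
    (hanR : ∀ X : (Sect2.domSys (F.P p.K) θ.τ9.M (k + 1)).Dom,
      AnalyticOnNhd ℂ (u.R (k + 1) X)
        ((sect2TowerOfRecord F N (FluctV N) p.K (settingOfRecord₁₃ F N θ.toStage13Params p) (θ.rzAt p s) s u).space (k + 1) X
          ((settingOfRecord₁₃ F N θ.toStage13Params p).lf.alpha0 ((settingOfRecord₁₃ F N θ.toStage13Params p).flow.g (k + 1))) ((settingOfRecord₁₃ F N θ.toStage13Params p).lf.alpha1 ((settingOfRecord₁₃ F N θ.toStage13Params p).flow.g (k + 1)))))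
    (hanB : ∀ (X : (Sect2.domSys (F.P p.K) θ.τ9.M (k + 1)).Dom) (a : SFluct (F.P p.K) (FluctV N)),
      AnalyticOnNhd ℂ (fun φ => u.B (k + 1) X φ a) ((sect2TowerOfRecord F N (FluctV N) p.K (settingOfRecord₁₃ F N θ.toStage13Params p) (θ.rzAt p s) s u).spaceB (k + 1) X)) :
    Sect2.LawsT (sect2TowerOfRecord F N (FluctV N) p.K (settingOfRecord₁₃ F N θ.toStage13Params p) (θ.rzAt p s) s (graftAboveB k tpar u)) (settingOfRecord₁₃ F N θ.toStage13Params p).lf (settingOfRecord₁₃ F N θ.toStage13Params p).βc k := by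
  refine lawsT_towerOfTerms_crossFrame (settingOfRecord₁₃ F N θ.toStage13Params p) (Rz := θ.rzAt p s.init) (Rz' := θ.rzAt p s) rfl rfl
    (Ω := s.init.Ω) (Ω' := s.Ω) (fun i hi => (seq_init_Ω_of_le s hi).symm) (t := tpar) (t' := graftAboveB k tpar u)
    (fun j hj X z g φ => graftAboveB_E_of_le tpar u hj X z g φ) (fun j hj X φ => graftAboveB_R_of_le tpar u hj X φ)
    (fun j hj X φ a => graftAboveB_B_of_lt tpar u hj X φ a) hlaw (fun h1 X φ a hφ => ?_) (fun h1 X a => ?_)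
    (lfNewTerms_graftAboveB _ _ _ hO2) (fun X z g hg0 hgγ => ?_) (fun X => ?_) (fun X a => ?_)
  · rw [graftAboveB_B_of_le tpar u le_rfl]; exact (hO1 h1).1 X φ a hφ
  · rw [graftAboveB_B_fun_of_le tpar u le_rfl]; exact (hO1 h1).2 X a
  · rw [graftAboveB_E_succ]; exact hanE X z g hg0 hgγ
  · rw [graftAboveB_R_succ]; exact hanR X
  · rw [graftAboveB_B_fun_of_le tpar u (Nat.le_succ k)]; exact hanB X a

end ChildLaws

/-! ## §3  The supply on the supplier's own terms: master guard, 𝐓-present children, labels -/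

section Supply

/-- **★ MASTER FORM** — as `…SpliceLabels.sect3SupplyAt_of_spliceSupply_of_guard` with the guarded children served by `graftAboveB k (t ∘ init) tnew` and (O1′) in place of
(O1): any guard `G` with `¬ G s′ ⇒ 𝐓ρ_k(s′) ≡ 0`; `0 ≤ E₀, B₀` for the zeroed terms elsewhere. [cite: Balaban1988Convergent, Theorem p.245, §2 p.262, §3 p.279, (3.24)–(3.25) p.270, (3.1) p.264, (2.25)–(2.28) p.259, (2.40)–(2.42) p.261] -/
theorem sect3SupplyAt_of_ownBSupply_of_guard {k : ℕ} (hE₀ : 0 ≤ θ.s2.lf.E₀) (hB₀ : 0 ≤ θ.s2.lf.B₀)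
    (G : SeqOfRecord F θ.ν θ.τ9.M (gOfRecord₁₃ F N θ.toStage13Params p) p.K (k + 1) → Prop)
    (hG : ∀ s : SeqOfRecord F θ.ν θ.τ9.M (gOfRecord₁₃ F N θ.toStage13Params p) p.K (k + 1), ¬ G s → slotsTOfRecord F N θ.ν θ.τ9 (EOfRecord₁₃ F N θ.toStage13Params) (wOfRecord₉ F N θ.toStage9Params) θ.ppSel p (gOfRecord₁₃ F N θ.toStage13Params p) (k + 1) s = 0)
    (h :
        ∀ (t : SeqOfRecord F θ.ν θ.τ9.M (gOfRecord₁₃ F N θ.toStage13Params p) p.K k → Sect2.TermValues (F.P p.K) (MatA N) (FluctV N) θ.τ9.M) (Ek : SeqOfRecord F θ.ν θ.τ9.M (gOfRecord₁₃ F N θ.toStage13Params p) p.K k → ℝ),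
          HasSect2FormAtZS F N (FluctV N) p.K (settingOfRecord₁₃ F N θ.toStage13Params p) k (θ.rzAt p) (WtOfRecord₁₃H F N θ p) (UbgOfRecord₁₃CoP F N θ.toStage13Params p k)
            (fun s u => Sect2.LawsRT (sect2TowerOfRecord F N (FluctV N) p.K (settingOfRecord₁₃ F N θ.toStage13Params p) (θ.rzAt p s) s u) (settingOfRecord₁₃ F N θ.toStage13Params p).lf k)
            (slotsOfRecord F N θ.ν θ.τ9 (EOfRecord₁₃ F N θ.toStage13Params) (wOfRecord₉ F N θ.toStage9Params) θ.ppSel p (gOfRecord₁₃ F N θ.toStage13Params p) k) t Ek →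
          ∃ (tnew : SeqOfRecord F θ.ν θ.τ9.M (gOfRecord₁₃ F N θ.toStage13Params p) p.K (k + 1) → Sect2.TermValues (F.P p.K) (MatA N) (FluctV N) θ.τ9.M) (EkN : SeqOfRecord F θ.ν θ.τ9.M (gOfRecord₁₃ F N θ.toStage13Params p) p.K (k + 1) → ℝ),
            Sect2.UniversalE tnew ∧
            ∀ s : SeqOfRecord F θ.ν θ.τ9.M (gOfRecord₁₃ F N θ.toStage13Params p) p.K (k + 1), s.Ω (k + 1) ≠ ∅ →
              G s →
              -- (O1′) the supplier's OWN level-`k` boundary term on the child's space `Ũ^c_k(X)`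
              (1 ≤ k →
                (∀ (X : (Sect2.domSys (F.P p.K) θ.τ9.M k).Dom) (φ : Sect2.CPair (F.P p.K) (MatA N)) (a : SFluct (F.P p.K) (FluctV N)),
                  φ ∈ (sect2TowerOfRecord F N (FluctV N) p.K (settingOfRecord₁₃ F N θ.toStage13Params p) (θ.rzAt p s) s (tnew s)).spaceB k X →
                    ‖(tnew s).B k X φ a‖ ≤ (settingOfRecord₁₃ F N θ.toStage13Params p).lf.B₀ * Real.exp (-(settingOfRecord₁₃ F N θ.toStage13Params p).lf.κ * (Sect2.domSys (F.P p.K) θ.τ9.M k).dj X)) ∧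
                (∀ (X : (Sect2.domSys (F.P p.K) θ.τ9.M k).Dom) (a : SFluct (F.P p.K) (FluctV N)),
                  AnalyticOnNhd ℂ (fun φ => (tnew s).B k X φ a)
                    ((sect2TowerOfRecord F N (FluctV N) p.K (settingOfRecord₁₃ F N θ.toStage13Params p) (θ.rzAt p s) s (tnew s)).spaceB k X))) ∧
              -- (O2) the new terms: r11's new-term obligations and analyticity at `k+1`
              Step.LFNewTerms (sect2TowerOfRecord F N (FluctV N) p.K (settingOfRecord₁₃ F N θ.toStage13Params p) (θ.rzAt p s) s (tnew s))
                (settingOfRecord₁₃ F N θ.toStage13Params p).lf (settingOfRecord₁₃ F N θ.toStage13Params p).βc k ∧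
              (∀ (X : (Sect2.domSys (F.P p.K) θ.τ9.M (k + 1)).Dom) (z : Site (F.P p.K) (k + 1)) (g : ℝ), 0 ≤ g → g ≤ (settingOfRecord₁₃ F N θ.toStage13Params p).lf.γ →
                AnalyticOnNhd ℂ ((tnew s).E (k + 1) X z g)
                  ((sect2TowerOfRecord F N (FluctV N) p.K (settingOfRecord₁₃ F N θ.toStage13Params p) (θ.rzAt p s) s (tnew s)).space (k + 1) X
                    ((settingOfRecord₁₃ F N θ.toStage13Params p).lf.alpha0 ((settingOfRecord₁₃ F N θ.toStage13Params p).flow.g (k + 1)))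
                    ((settingOfRecord₁₃ F N θ.toStage13Params p).lf.alpha1 ((settingOfRecord₁₃ F N θ.toStage13Params p).flow.g (k + 1))))) ∧
              (∀ X : (Sect2.domSys (F.P p.K) θ.τ9.M (k + 1)).Dom,
                AnalyticOnNhd ℂ ((tnew s).R (k + 1) X)
                  ((sect2TowerOfRecord F N (FluctV N) p.K (settingOfRecord₁₃ F N θ.toStage13Params p) (θ.rzAt p s) s (tnew s)).space (k + 1) X
                    ((settingOfRecord₁₃ F N θ.toStage13Params p).lf.alpha0 ((settingOfRecord₁₃ F N θ.toStage13Params p).flow.g (k + 1)))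
                    ((settingOfRecord₁₃ F N θ.toStage13Params p).lf.alpha1 ((settingOfRecord₁₃ F N θ.toStage13Params p).flow.g (k + 1))))) ∧
              (∀ (X : (Sect2.domSys (F.P p.K) θ.τ9.M (k + 1)).Dom) (a : SFluct (F.P p.K) (FluctV N)),
                AnalyticOnNhd ℂ (fun φ => (tnew s).B (k + 1) X φ a)
                  ((sect2TowerOfRecord F N (FluctV N) p.K (settingOfRecord₁₃ F N θ.toStage13Params p) (θ.rzAt p s) s (tnew s)).spaceB (k + 1) X)) ∧
              -- (O3′) the 𝐓-image clause for the spliced witness with the supplier's own `𝐁^{(k)}`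
              (slotsTOfRecord F N θ.ν θ.τ9 (EOfRecord₁₃ F N θ.toStage13Params) (wOfRecord₉ F N θ.toStage9Params) θ.ppSel p
                  (gOfRecord₁₃ F N θ.toStage13Params p) (k + 1) s = 0 ∨
                ∀ᵐ V' ∂fieldMeasure (F.P p.K) (k + 1) (SU N),
                  chiSeqOfRecord F N θ.ν θ.τ9.M (gOfRecord₁₃ F N θ.toStage13Params p) p.K (k + 1) s V' ≠ 0 →
                    slotsTOfRecord F N θ.ν θ.τ9 (EOfRecord₁₃ F N θ.toStage13Params) (wOfRecord₉ F N θ.toStage9Params) θ.ppSel p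
                        (gOfRecord₁₃ F N θ.toStage13Params p) (k + 1) s V' =
                      sect2Slot F N (FluctV N) p.K (settingOfRecord₁₃ F N θ.toStage13Params p) (θ.rzAt p s) (WtOfRecord₁₃H F N θ p s) s
                        (graftAboveB k (t s.init) (tnew s)) (EkN s) (UbgOfRecord₁₃CoP F N θ.toStage13Params p (k + 1) s) V')) :
    Sect3SupplyAt θ p k := by
  classical
  intro t Ek hS
  obtain ⟨hu, hs⟩ := hS
  obtain ⟨tnew, EkN, huN, hx⟩ := h t Ek ⟨hu, hs⟩
  have hbook : ∀ (s : SeqOfRecord F θ.ν θ.τ9.M (gOfRecord₁₃ F N θ.toStage13Params p) p.K (k + 1)) (v : Sect2.TermValues (F.P p.K) (MatA N) (FluctV N) θ.τ9.M),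
      (∀ j, j ≤ k → ∀ X z g φ, (graftAbove k (t s.init) (zeroRB v)).E j X z g φ = (t s.init).E j X z g φ) ∧
      (∀ j, j ≤ k → ∀ X φ, (graftAbove k (t s.init) (zeroRB v)).R j X φ = (t s.init).R j X φ) ∧
      (∀ j, j ≤ k → ∀ X φ a, (graftAbove k (t s.init) (zeroRB v)).B j X φ a = (t s.init).B j X φ a) ∧
      (∀ X φ, (graftAbove k (t s.init) (zeroRB v)).R (k + 1) X φ = 0) ∧ (∀ X φ a, (graftAbove k (t s.init) (zeroRB v)).B (k + 1) X φ a = 0) := fun s v =>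
    ⟨fun j hj X z g φ => graftAbove_E_of_le _ _ hj X z g φ, fun j hj X φ => graftAbove_R_of_le _ _ hj X φ, fun j hj X φ a => graftAbove_B_of_le _ _ hj X φ a,
      fun X φ => by rw [graftAbove_R_of_lt _ _ (Nat.lt_succ_self k)]; rfl, fun X φ a => by rw [graftAbove_B_of_lt _ _ (Nat.lt_succ_self k)]; rfl⟩
  by_cases hex : ∃ s₁ : SeqOfRecord F θ.ν θ.τ9.M (gOfRecord₁₃ F N θ.toStage13Params p) p.K (k + 1), s₁.Ω (k + 1) ≠ ∅ ∧ G s₁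
  · obtain ⟨s₁, hs₁Ω, hs₁ρ⟩ := hex
    have hLpres : ∀ s : SeqOfRecord F θ.ν θ.τ9.M (gOfRecord₁₃ F N θ.toStage13Params p) p.K (k + 1), s.Ω (k + 1) ≠ ∅ → G s →
        Sect2.LawsT (sect2TowerOfRecord F N (FluctV N) p.K (settingOfRecord₁₃ F N θ.toStage13Params p) (θ.rzAt p s) s (graftAboveB k (t s.init) (tnew s)))
          (settingOfRecord₁₃ F N θ.toStage13Params p).lf (settingOfRecord₁₃ F N θ.toStage13Params p).βc k := fun s hsΩ hsρ =>
      lawsT_child_graftAboveB_of_rows θ p s (hs s.init).1 (hx s hsΩ hsρ).1 (hx s hsΩ hsρ).2.1 (hx s hsΩ hsρ).2.2.1 (hx s hsΩ hsρ).2.2.2.1 (hx s hsΩ hsρ).2.2.2.2.1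
    obtain ⟨tT, htT⟩ : ∃ tT : SeqOfRecord F θ.ν θ.τ9.M (gOfRecord₁₃ F N θ.toStage13Params p) p.K (k + 1) → Sect2.TermValues (F.P p.K) (MatA N) (FluctV N) θ.τ9.M,
        ∀ s, tT s = if s.Ω (k + 1) = ∅ then graftAbove k (t s.init) (zeroRB (tnew s)) else
          if G s then graftAboveB k (t s.init) (tnew s) else graftAbove k (dropBFrom k (t s.init)) (zeroRB (tnew s)) := ⟨_, fun _ => rfl⟩
    obtain ⟨EkT, hEkT⟩ : ∃ EkT : SeqOfRecord F θ.ν θ.τ9.M (gOfRecord₁₃ F N θ.toStage13Params p) p.K (k + 1) → ℝ, ∀ s, EkT s = if s.Ω (k + 1) = ∅ then Ek s.init else EkN s := ⟨_, fun _ => rfl⟩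
    have hTE : ∀ s, (tT s).E = (graftAbove k (t s.init) (tnew s)).E := fun s => by
      rw [htT s]; split_ifs <;> rfl
    refine ⟨tT, EkT, universalE_graftAbove hu huN k (fun s => s.init) tT hTE, fun s hΩ => ?_, fun s hsΩ => ?_⟩
    · rw [htT s, if_pos hΩ]
      obtain ⟨h1, h2, h3, h4, h5⟩ := hbook s (tnew s)
      exact ⟨h1, h2, h3, h4, h5, by rw [hEkT s, if_pos hΩ]⟩
    · by_cases hsρ : G s
      · rw [htT s, if_neg hsΩ, if_pos hsρ]
        refine ⟨hLpres s hsΩ hsρ, ?_⟩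
        rw [hEkT s, if_neg hsΩ]
        exact (hx s hsΩ hsρ).2.2.2.2.2
      · rw [htT s, if_neg hsΩ, if_neg hsρ]
        refine ⟨lawsT_child_absent_of_newEClauses θ p hB₀ s (hs s.init).1 ?_, Or.inl (hG s hsρ)⟩
        have hEE : (graftAbove k (dropBFrom k (t s.init)) (zeroRB (tnew s))).E = (graftAboveB k (t s₁.init) (tnew s₁)).E := by
          rw [graftAbove_E, graftAboveB_E, graftAbove_E]
          funext j X z g φ
          show (if j ≤ k then (t s.init).E j X z g φ else (tnew s).E j X z g φ) = if j ≤ k then (t s₁.init).E j X z g φ else (tnew s₁).E j X z g φ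
          rw [hu s.init s₁.init, huN s s₁]
        exact newEClauses_of_lawsT_of_eqE (settingOfRecord₁₃ F N θ.toStage13Params p) (Rz := θ.rzAt p s₁) (Rz' := θ.rzAt p s) rfl s₁.Ω s.Ω hEE (hLpres s₁ hs₁Ω hs₁ρ)
  · have habs : ∀ s : SeqOfRecord F θ.ν θ.τ9.M (gOfRecord₁₃ F N θ.toStage13Params p) p.K (k + 1), s.Ω (k + 1) ≠ ∅ → ¬ G s := fun s hsΩ hG' => hex ⟨s, hsΩ, hG'⟩
    obtain ⟨tT, htT⟩ : ∃ tT : SeqOfRecord F θ.ν θ.τ9.M (gOfRecord₁₃ F N θ.toStage13Params p) p.K (k + 1) → Sect2.TermValues (F.P p.K) (MatA N) (FluctV N) θ.τ9.M,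
        ∀ s, tT s = if s.Ω (k + 1) = ∅ then graftAbove k (t s.init) (zeroRB Sect2.TermValues.zero) else
          graftAbove k (dropBFrom k (t s.init)) (zeroRB Sect2.TermValues.zero) := ⟨_, fun _ => rfl⟩
    have hTE : ∀ s, (tT s).E = (graftAbove k (t s.init) ((fun _ => (Sect2.TermValues.zero : Sect2.TermValues (F.P p.K) (MatA N) (FluctV N) θ.τ9.M)) s)).E := fun s => by
      rw [htT s]; split_ifs <;> rfl
    refine ⟨tT, fun s => Ek s.init, universalE_graftAbove hu (Sect2.universalE_const _) k (fun s => s.init) tT hTE, fun s hΩ => ?_, fun s hsΩ => ?_⟩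
    · rw [htT s, if_pos hΩ]
      obtain ⟨h1, h2, h3, h4, h5⟩ := hbook s Sect2.TermValues.zero
      exact ⟨h1, h2, h3, h4, h5, rfl⟩
    · rw [htT s, if_neg hsΩ]
      refine ⟨lawsT_child_absent_of_newEClauses θ p hB₀ s (hs s.init).1 ?_, Or.inl (hG s (habs s hsΩ))⟩
      exact newEClauses_of_zeroE (settingOfRecord₁₃ F N θ.toStage13Params p) (θ.rzAt p s) s.Ω
        (fun X z g φ => by rw [graftAbove_E_of_lt _ _ (Nat.lt_succ_self k)]; rfl) hE₀

/-- **★★ THE SUPPLY ON THE SUPPLIER's OWN TERMS AT THE 𝐓-PRESENT EXPANSION CHILDREN** (guard `𝐓ρ_k(s′) ≢ 0`, the weakest). [cite: Balaban1988Convergent, Theorem p.245, §3 p.279, (3.24)–(3.25) p.270, (3.1)–(3.5) pp.264–265] -/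
theorem sect3SupplyAt_of_ownBSupply_at_present_children {k : ℕ} (hE₀ : 0 ≤ θ.s2.lf.E₀) (hB₀ : 0 ≤ θ.s2.lf.B₀)
    (h :
        ∀ (t : SeqOfRecord F θ.ν θ.τ9.M (gOfRecord₁₃ F N θ.toStage13Params p) p.K k → Sect2.TermValues (F.P p.K) (MatA N) (FluctV N) θ.τ9.M) (Ek : SeqOfRecord F θ.ν θ.τ9.M (gOfRecord₁₃ F N θ.toStage13Params p) p.K k → ℝ),
          HasSect2FormAtZS F N (FluctV N) p.K (settingOfRecord₁₃ F N θ.toStage13Params p) k (θ.rzAt p) (WtOfRecord₁₃H F N θ p) (UbgOfRecord₁₃CoP F N θ.toStage13Params p k)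
            (fun s u => Sect2.LawsRT (sect2TowerOfRecord F N (FluctV N) p.K (settingOfRecord₁₃ F N θ.toStage13Params p) (θ.rzAt p s) s u) (settingOfRecord₁₃ F N θ.toStage13Params p).lf k)
            (slotsOfRecord F N θ.ν θ.τ9 (EOfRecord₁₃ F N θ.toStage13Params) (wOfRecord₉ F N θ.toStage9Params) θ.ppSel p (gOfRecord₁₃ F N θ.toStage13Params p) k) t Ek →
          ∃ (tnew : SeqOfRecord F θ.ν θ.τ9.M (gOfRecord₁₃ F N θ.toStage13Params p) p.K (k + 1) → Sect2.TermValues (F.P p.K) (MatA N) (FluctV N) θ.τ9.M) (EkN : SeqOfRecord F θ.ν θ.τ9.M (gOfRecord₁₃ F N θ.toStage13Params p) p.K (k + 1) → ℝ),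
            Sect2.UniversalE tnew ∧
            ∀ s : SeqOfRecord F θ.ν θ.τ9.M (gOfRecord₁₃ F N θ.toStage13Params p) p.K (k + 1), s.Ω (k + 1) ≠ ∅ →
              slotsTOfRecord F N θ.ν θ.τ9 (EOfRecord₁₃ F N θ.toStage13Params) (wOfRecord₉ F N θ.toStage9Params) θ.ppSel p
                  (gOfRecord₁₃ F N θ.toStage13Params p) (k + 1) s ≠ 0 →
              -- (O1′) the supplier's OWN level-`k` boundary term on the child's space `Ũ^c_k(X)`
              (1 ≤ k →
                (∀ (X : (Sect2.domSys (F.P p.K) θ.τ9.M k).Dom) (φ : Sect2.CPair (F.P p.K) (MatA N)) (a : SFluct (F.P p.K) (FluctV N)),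
                  φ ∈ (sect2TowerOfRecord F N (FluctV N) p.K (settingOfRecord₁₃ F N θ.toStage13Params p) (θ.rzAt p s) s (tnew s)).spaceB k X →
                    ‖(tnew s).B k X φ a‖ ≤ (settingOfRecord₁₃ F N θ.toStage13Params p).lf.B₀ * Real.exp (-(settingOfRecord₁₃ F N θ.toStage13Params p).lf.κ * (Sect2.domSys (F.P p.K) θ.τ9.M k).dj X)) ∧
                (∀ (X : (Sect2.domSys (F.P p.K) θ.τ9.M k).Dom) (a : SFluct (F.P p.K) (FluctV N)),
                  AnalyticOnNhd ℂ (fun φ => (tnew s).B k X φ a)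
                    ((sect2TowerOfRecord F N (FluctV N) p.K (settingOfRecord₁₃ F N θ.toStage13Params p) (θ.rzAt p s) s (tnew s)).spaceB k X))) ∧
              -- (O2) the new terms: r11's new-term obligations and analyticity at `k+1`
              Step.LFNewTerms (sect2TowerOfRecord F N (FluctV N) p.K (settingOfRecord₁₃ F N θ.toStage13Params p) (θ.rzAt p s) s (tnew s))
                (settingOfRecord₁₃ F N θ.toStage13Params p).lf (settingOfRecord₁₃ F N θ.toStage13Params p).βc k ∧
              (∀ (X : (Sect2.domSys (F.P p.K) θ.τ9.M (k + 1)).Dom) (z : Site (F.P p.K) (k + 1)) (g : ℝ), 0 ≤ g → g ≤ (settingOfRecord₁₃ F N θ.toStage13Params p).lf.γ →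
                AnalyticOnNhd ℂ ((tnew s).E (k + 1) X z g)
                  ((sect2TowerOfRecord F N (FluctV N) p.K (settingOfRecord₁₃ F N θ.toStage13Params p) (θ.rzAt p s) s (tnew s)).space (k + 1) X
                    ((settingOfRecord₁₃ F N θ.toStage13Params p).lf.alpha0 ((settingOfRecord₁₃ F N θ.toStage13Params p).flow.g (k + 1)))
                    ((settingOfRecord₁₃ F N θ.toStage13Params p).lf.alpha1 ((settingOfRecord₁₃ F N θ.toStage13Params p).flow.g (k + 1))))) ∧
              (∀ X : (Sect2.domSys (F.P p.K) θ.τ9.M (k + 1)).Dom,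
                AnalyticOnNhd ℂ ((tnew s).R (k + 1) X)
                  ((sect2TowerOfRecord F N (FluctV N) p.K (settingOfRecord₁₃ F N θ.toStage13Params p) (θ.rzAt p s) s (tnew s)).space (k + 1) X
                    ((settingOfRecord₁₃ F N θ.toStage13Params p).lf.alpha0 ((settingOfRecord₁₃ F N θ.toStage13Params p).flow.g (k + 1)))
                    ((settingOfRecord₁₃ F N θ.toStage13Params p).lf.alpha1 ((settingOfRecord₁₃ F N θ.toStage13Params p).flow.g (k + 1))))) ∧
              (∀ (X : (Sect2.domSys (F.P p.K) θ.τ9.M (k + 1)).Dom) (a : SFluct (F.P p.K) (FluctV N)),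
                AnalyticOnNhd ℂ (fun φ => (tnew s).B (k + 1) X φ a)
                  ((sect2TowerOfRecord F N (FluctV N) p.K (settingOfRecord₁₃ F N θ.toStage13Params p) (θ.rzAt p s) s (tnew s)).spaceB (k + 1) X)) ∧
              -- (O3′) the 𝐓-image clause for the spliced witness with the supplier's own `𝐁^{(k)}`
              (slotsTOfRecord F N θ.ν θ.τ9 (EOfRecord₁₃ F N θ.toStage13Params) (wOfRecord₉ F N θ.toStage9Params) θ.ppSel p
                  (gOfRecord₁₃ F N θ.toStage13Params p) (k + 1) s = 0 ∨
                ∀ᵐ V' ∂fieldMeasure (F.P p.K) (k + 1) (SU N),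
                  chiSeqOfRecord F N θ.ν θ.τ9.M (gOfRecord₁₃ F N θ.toStage13Params p) p.K (k + 1) s V' ≠ 0 →
                    slotsTOfRecord F N θ.ν θ.τ9 (EOfRecord₁₃ F N θ.toStage13Params) (wOfRecord₉ F N θ.toStage9Params) θ.ppSel p
                        (gOfRecord₁₃ F N θ.toStage13Params p) (k + 1) s V' =
                      sect2Slot F N (FluctV N) p.K (settingOfRecord₁₃ F N θ.toStage13Params p) (θ.rzAt p s) (WtOfRecord₁₃H F N θ p s) s
                        (graftAboveB k (t s.init) (tnew s)) (EkN s) (UbgOfRecord₁₃CoP F N θ.toStage13Params p (k + 1) s) V')) :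
    Sect3SupplyAt θ p k :=
  sect3SupplyAt_of_ownBSupply_of_guard θ p hE₀ hB₀ (fun s => slotsTOfRecord F N θ.ν θ.τ9 (EOfRecord₁₃ F N θ.toStage13Params) (wOfRecord₉ F N θ.toStage9Params) θ.ppSel p (gOfRecord₁₃ F N θ.toStage13Params p) (k + 1) s ≠ 0) (fun _ hs => not_not.mp hs) h

/-- **★★★ [III] §3's SUPPLY ON THE SUPPLIER's OWN TERMS, IN PRINT's OWN INDEXING**: for every exposed witness `(t, E_k)` of `ρ_k`'s §2 form, ∃ `tnew` (universal in 𝐄) and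
`EkN` such that for every history `s₀` of length `k` and every LABEL `t = (P, Q, R, S)_{k+1}` (index map `σOfRecord … k s₀ t` of (3.5)∕(3.20)), IF `Ω_{k+1}(t) ≠ ∅` and
`𝐓ρ_k(σ s₀ t) ≢ 0` THEN: (O1′) the supplier's `𝐁^{(k)}` at `σ s₀ t` obeys (2.42) ∕ (2.41)(ii) on the child's `Ũ^c_k(X)` (void at `k = 0`) · (O2) r11's new-term obligations +
analyticity at `k+1` for `tnew (σ s₀ t)` (Thm 2's clauses) · (O3′) the 𝐓-image identity at `σ s₀ t` for `graftAboveB k (t s₀) (tnew (σ s₀ t)), EkN (σ s₀ t)` — EVERY clause on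
the supplier's own terms (the exposed witness enters only through the values of its old terms inside `A_{k+1}`).  ⇒ `Sect3SupplyAt θ p k`.
[cite: Balaban1988Convergent, Theorem p.245, Thm 2 p.263, §3 p.279, (3.1)–(3.5) pp.264–265, (3.16)–(3.20) pp.268–269, (3.24)–(3.25) p.270, (2.40)–(2.42) p.261] -/
theorem sect3SupplyAt_of_ownBSupply_at_labels {k : ℕ} (hE₀ : 0 ≤ θ.s2.lf.E₀) (hB₀ : 0 ≤ θ.s2.lf.B₀)
    (h :
        ∀ (t : SeqOfRecord F θ.ν θ.τ9.M (gOfRecord₁₃ F N θ.toStage13Params p) p.K k → Sect2.TermValues (F.P p.K) (MatA N) (FluctV N) θ.τ9.M) (Ek : SeqOfRecord F θ.ν θ.τ9.M (gOfRecord₁₃ F N θ.toStage13Params p) p.K k → ℝ),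
          HasSect2FormAtZS F N (FluctV N) p.K (settingOfRecord₁₃ F N θ.toStage13Params p) k (θ.rzAt p) (WtOfRecord₁₃H F N θ p) (UbgOfRecord₁₃CoP F N θ.toStage13Params p k)
            (fun s u => Sect2.LawsRT (sect2TowerOfRecord F N (FluctV N) p.K (settingOfRecord₁₃ F N θ.toStage13Params p) (θ.rzAt p s) s u) (settingOfRecord₁₃ F N θ.toStage13Params p).lf k)
            (slotsOfRecord F N θ.ν θ.τ9 (EOfRecord₁₃ F N θ.toStage13Params) (wOfRecord₉ F N θ.toStage9Params) θ.ppSel p (gOfRecord₁₃ F N θ.toStage13Params p) k) t Ek →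
          ∃ (tnew : SeqOfRecord F θ.ν θ.τ9.M (gOfRecord₁₃ F N θ.toStage13Params p) p.K (k + 1) → Sect2.TermValues (F.P p.K) (MatA N) (FluctV N) θ.τ9.M) (EkN : SeqOfRecord F θ.ν θ.τ9.M (gOfRecord₁₃ F N θ.toStage13Params p) p.K (k + 1) → ℝ),
            Sect2.UniversalE tnew ∧
            ∀ (s₀ : SeqOfRecord F θ.ν θ.τ9.M (gOfRecord₁₃ F N θ.toStage13Params p) p.K k) (lab : LbOfRecord F θ.ν p (gOfRecord₁₃ F N θ.toStage13Params p) k),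
              (σOfRecord F θ.ν θ.τ9.M p (gOfRecord₁₃ F N θ.toStage13Params p) k s₀ lab).Ω (k + 1) ≠ ∅ →
              slotsTOfRecord F N θ.ν θ.τ9 (EOfRecord₁₃ F N θ.toStage13Params) (wOfRecord₉ F N θ.toStage9Params) θ.ppSel p
                  (gOfRecord₁₃ F N θ.toStage13Params p) (k + 1) (σOfRecord F θ.ν θ.τ9.M p (gOfRecord₁₃ F N θ.toStage13Params p) k s₀ lab) ≠ 0 →
              -- (O1′) the supplier's OWN level-`k` boundary term on the child's space `Ũ^c_k(X)`
              (1 ≤ k →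
                (∀ (X : (Sect2.domSys (F.P p.K) θ.τ9.M k).Dom) (φ : Sect2.CPair (F.P p.K) (MatA N)) (a : SFluct (F.P p.K) (FluctV N)),
                  φ ∈ (sect2TowerOfRecord F N (FluctV N) p.K (settingOfRecord₁₃ F N θ.toStage13Params p) (θ.rzAt p (σOfRecord F θ.ν θ.τ9.M p (gOfRecord₁₃ F N θ.toStage13Params p) k s₀ lab)) (σOfRecord F θ.ν θ.τ9.M p (gOfRecord₁₃ F N θ.toStage13Params p) k s₀ lab) (tnew (σOfRecord F θ.ν θ.τ9.M p (gOfRecord₁₃ F N θ.toStage13Params p) k s₀ lab))).spaceB k X →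
                    ‖(tnew (σOfRecord F θ.ν θ.τ9.M p (gOfRecord₁₃ F N θ.toStage13Params p) k s₀ lab)).B k X φ a‖ ≤ (settingOfRecord₁₃ F N θ.toStage13Params p).lf.B₀ * Real.exp (-(settingOfRecord₁₃ F N θ.toStage13Params p).lf.κ * (Sect2.domSys (F.P p.K) θ.τ9.M k).dj X)) ∧
                (∀ (X : (Sect2.domSys (F.P p.K) θ.τ9.M k).Dom) (a : SFluct (F.P p.K) (FluctV N)),
                  AnalyticOnNhd ℂ (fun φ => (tnew (σOfRecord F θ.ν θ.τ9.M p (gOfRecord₁₃ F N θ.toStage13Params p) k s₀ lab)).B k X φ a)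
                    ((sect2TowerOfRecord F N (FluctV N) p.K (settingOfRecord₁₃ F N θ.toStage13Params p) (θ.rzAt p (σOfRecord F θ.ν θ.τ9.M p (gOfRecord₁₃ F N θ.toStage13Params p) k s₀ lab)) (σOfRecord F θ.ν θ.τ9.M p (gOfRecord₁₃ F N θ.toStage13Params p) k s₀ lab) (tnew (σOfRecord F θ.ν θ.τ9.M p (gOfRecord₁₃ F N θ.toStage13Params p) k s₀ lab))).spaceB k X))) ∧
              -- (O2) the new terms: r11's new-term obligations and analyticity at `k+1`
              Step.LFNewTerms (sect2TowerOfRecord F N (FluctV N) p.K (settingOfRecord₁₃ F N θ.toStage13Params p) (θ.rzAt p (σOfRecord F θ.ν θ.τ9.M p (gOfRecord₁₃ F N θ.toStage13Params p) k s₀ lab)) (σOfRecord F θ.ν θ.τ9.M p (gOfRecord₁₃ F N θ.toStage13Params p) k s₀ lab) (tnew (σOfRecord F θ.ν θ.τ9.M p (gOfRecord₁₃ F N θ.toStage13Params p) k s₀ lab)))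
                (settingOfRecord₁₃ F N θ.toStage13Params p).lf (settingOfRecord₁₃ F N θ.toStage13Params p).βc k ∧
              (∀ (X : (Sect2.domSys (F.P p.K) θ.τ9.M (k + 1)).Dom) (z : Site (F.P p.K) (k + 1)) (g : ℝ), 0 ≤ g → g ≤ (settingOfRecord₁₃ F N θ.toStage13Params p).lf.γ →
                AnalyticOnNhd ℂ ((tnew (σOfRecord F θ.ν θ.τ9.M p (gOfRecord₁₃ F N θ.toStage13Params p) k s₀ lab)).E (k + 1) X z g)
                  ((sect2TowerOfRecord F N (FluctV N) p.K (settingOfRecord₁₃ F N θ.toStage13Params p) (θ.rzAt p (σOfRecord F θ.ν θ.τ9.M p (gOfRecord₁₃ F N θ.toStage13Params p) k s₀ lab)) (σOfRecord F θ.ν θ.τ9.M p (gOfRecord₁₃ F N θ.toStage13Params p) k s₀ lab) (tnew (σOfRecord F θ.ν θ.τ9.M p (gOfRecord₁₃ F N θ.toStage13Params p) k s₀ lab))).space (k + 1) X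
                    ((settingOfRecord₁₃ F N θ.toStage13Params p).lf.alpha0 ((settingOfRecord₁₃ F N θ.toStage13Params p).flow.g (k + 1)))
                    ((settingOfRecord₁₃ F N θ.toStage13Params p).lf.alpha1 ((settingOfRecord₁₃ F N θ.toStage13Params p).flow.g (k + 1))))) ∧
              (∀ X : (Sect2.domSys (F.P p.K) θ.τ9.M (k + 1)).Dom,
                AnalyticOnNhd ℂ ((tnew (σOfRecord F θ.ν θ.τ9.M p (gOfRecord₁₃ F N θ.toStage13Params p) k s₀ lab)).R (k + 1) X)
                  ((sect2TowerOfRecord F N (FluctV N) p.K (settingOfRecord₁₃ F N θ.toStage13Params p) (θ.rzAt p (σOfRecord F θ.ν θ.τ9.M p (gOfRecord₁₃ F N θ.toStage13Params p) k s₀ lab)) (σOfRecord F θ.ν θ.τ9.M p (gOfRecord₁₃ F N θ.toStage13Params p) k s₀ lab) (tnew (σOfRecord F θ.ν θ.τ9.M p (gOfRecord₁₃ F N θ.toStage13Params p) k s₀ lab))).space (k + 1) X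
                    ((settingOfRecord₁₃ F N θ.toStage13Params p).lf.alpha0 ((settingOfRecord₁₃ F N θ.toStage13Params p).flow.g (k + 1)))
                    ((settingOfRecord₁₃ F N θ.toStage13Params p).lf.alpha1 ((settingOfRecord₁₃ F N θ.toStage13Params p).flow.g (k + 1))))) ∧
              (∀ (X : (Sect2.domSys (F.P p.K) θ.τ9.M (k + 1)).Dom) (a : SFluct (F.P p.K) (FluctV N)),
                AnalyticOnNhd ℂ (fun φ => (tnew (σOfRecord F θ.ν θ.τ9.M p (gOfRecord₁₃ F N θ.toStage13Params p) k s₀ lab)).B (k + 1) X φ a)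
                  ((sect2TowerOfRecord F N (FluctV N) p.K (settingOfRecord₁₃ F N θ.toStage13Params p) (θ.rzAt p (σOfRecord F θ.ν θ.τ9.M p (gOfRecord₁₃ F N θ.toStage13Params p) k s₀ lab)) (σOfRecord F θ.ν θ.τ9.M p (gOfRecord₁₃ F N θ.toStage13Params p) k s₀ lab) (tnew (σOfRecord F θ.ν θ.τ9.M p (gOfRecord₁₃ F N θ.toStage13Params p) k s₀ lab))).spaceB (k + 1) X)) ∧
              -- (O3′) the 𝐓-image clause for the spliced witness with the supplier's own `𝐁^{(k)}`
              (slotsTOfRecord F N θ.ν θ.τ9 (EOfRecord₁₃ F N θ.toStage13Params) (wOfRecord₉ F N θ.toStage9Params) θ.ppSel p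
                  (gOfRecord₁₃ F N θ.toStage13Params p) (k + 1) (σOfRecord F θ.ν θ.τ9.M p (gOfRecord₁₃ F N θ.toStage13Params p) k s₀ lab) = 0 ∨
                ∀ᵐ V' ∂fieldMeasure (F.P p.K) (k + 1) (SU N),
                  chiSeqOfRecord F N θ.ν θ.τ9.M (gOfRecord₁₃ F N θ.toStage13Params p) p.K (k + 1) (σOfRecord F θ.ν θ.τ9.M p (gOfRecord₁₃ F N θ.toStage13Params p) k s₀ lab) V' ≠ 0 →
                    slotsTOfRecord F N θ.ν θ.τ9 (EOfRecord₁₃ F N θ.toStage13Params) (wOfRecord₉ F N θ.toStage9Params) θ.ppSel p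
                        (gOfRecord₁₃ F N θ.toStage13Params p) (k + 1) (σOfRecord F θ.ν θ.τ9.M p (gOfRecord₁₃ F N θ.toStage13Params p) k s₀ lab) V' =
                      sect2Slot F N (FluctV N) p.K (settingOfRecord₁₃ F N θ.toStage13Params p) (θ.rzAt p (σOfRecord F θ.ν θ.τ9.M p (gOfRecord₁₃ F N θ.toStage13Params p) k s₀ lab)) (WtOfRecord₁₃H F N θ p (σOfRecord F θ.ν θ.τ9.M p (gOfRecord₁₃ F N θ.toStage13Params p) k s₀ lab)) (σOfRecord F θ.ν θ.τ9.M p (gOfRecord₁₃ F N θ.toStage13Params p) k s₀ lab)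
                        (graftAboveB k (t s₀) (tnew (σOfRecord F θ.ν θ.τ9.M p (gOfRecord₁₃ F N θ.toStage13Params p) k s₀ lab))) (EkN (σOfRecord F θ.ν θ.τ9.M p (gOfRecord₁₃ F N θ.toStage13Params p) k s₀ lab)) (UbgOfRecord₁₃CoP F N θ.toStage13Params p (k + 1) (σOfRecord F θ.ν θ.τ9.M p (gOfRecord₁₃ F N θ.toStage13Params p) k s₀ lab)) V')) :
    Sect3SupplyAt θ p k := by
  refine sect3SupplyAt_of_ownBSupply_at_present_children θ p hE₀ hB₀ fun t Ek hS => ?_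
  obtain ⟨tnew, EkN, huN, hx⟩ := h t Ek hS
  refine ⟨tnew, EkN, huN, fun s hsΩ hsT => ?_⟩
  obtain ⟨lab, hlab⟩ := exists_label_of_slotsTOfRecord_succ_ne_zero F N θ.ν θ.τ9 (EOfRecord₁₃ F N θ.toStage13Params) θ.ppSel p (gOfRecord₁₃ F N θ.toStage13Params p) k
    θ.A₁ θ.ζ s hsT
  have H := hx s.init lab
  rw [hlab] at H
  exact H hsΩ hsT

end Supply

end Summit.QuantumFields.YangMills.Theorems.BalabanUVNodesN11Sect3SupplySpliceOwnBoundary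

end
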